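import Mathlib
import Literature.NumberTheory.Automorphic.GaloisActionPlaces
import Literature.NumberTheory.Automorphic.AutomorphicInductionUnitaryCharacterCubicResolventDescent
import Summits.Langlands.Langlands.Theorems.PicardMuOrdinaryResidualAutomorphyEvenTower

/-!
# Places of the cubic resolvent field over `v` ↔ Frobenius orbits on the pairings (Stage D2a)

Helper file for item stmt-Langlands-13760 (route `PicardMuOrdinary`).  `K ⊆ E = M^H ⊆ M`, `G = Gal(M/K)`,
`H = Stab(pairing 0)`.  Fix a place `v` of `K`, a prime `W ∣ v` of `𝓞 M` and `g ∈ G` with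
`D = Stab_G(W) = ⟨g⟩` (this is the unramified situation, `g` the Frobenius).  The primes of `𝓞 E`
above `v` are the `(σ W) ∩ 𝓞 E`, and `(σ W) ∩ 𝓞 E = (τ W) ∩ 𝓞 E` iff `τ ∈ H σ D`, i.e. iff the
pairings `σ⁻¹ · 0` and `τ⁻¹ · 0` lie in the same `⟨g⟩`-orbit (Dedekind–Hilbert: primes of the
subextension ↔ double cosets).  We construct the resulting map

  `placeOf : Pairing → HeightOneSpectrum (𝓞 E)`, `p ↦ (σ_p W) ∩ 𝓞 E` (`σ_p p = 0`),

prove it hits every place of `E` above `v` (`exists_placeOf_eq`), identify its fibres with the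
`⟨g⟩`-orbits (`placeOf_eq_placeOf_iff`), and compute the residue degree
`f(placeOf p | v) = period (perm4 g) p` (`inertiaDeg_placeOf`).  Unconditional.
-/

set_option linter.dupNamespace false -- project-wide option (lakefile weak.linter.dupNamespace); `Summit.Langlands.Langlands` is the mandated namespace

noncomputable section

namespace Summit.Langlands.Langlands.Theorems.ResidualAutomorphyEven

open Polynomial Equiv Finset NumberField Pairing IsDedekindDomain
open scoped Classical Pointwise

variable {f : ℤ[X]} (h : IsSepQuartic f)

/-! ### `Gal(M/E)` and the stabiliser `H` -/

/-- The Galois group `Gal(M/E)` of `M` over the cubic resolvent field. -/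
abbrev GE : Type := M f ≃ₐ[E h] M f

/-- `H ≅ Gal(M/E)` (Galois correspondence, Mathlib `IntermediateField.subgroupEquivAlgEquiv`). -/
def toGE : stabPairing h ≃* GE h := IntermediateField.subgroupEquivAlgEquiv (stabPairing h)

/-- `toGE` does not change the underlying automorphism of `M`. -/
@[simp] theorem toGE_apply (σ : stabPairing h) (x : M f) : toGE h σ x = (σ : G f) x := rfl

/-- An `E`-automorphism restricts to an element of `H`. -/
theorem toGE_symm_coe_apply (φ : GE h) (x : M f) : ((toGE h).symm φ : G f) x = φ x := by
  conv_rhs => rw [← (toGE h).apply_symm_apply φ]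
  rfl

/-- The two actions on ideals of `𝓞 M` agree along `toGE`. -/
theorem toGE_smul_ideal (σ : stabPairing h) (I : Ideal (𝓞 (M f))) : toGE h σ • I = (σ : G f) • I := by
  rw [Ideal.pointwise_smul_def, Ideal.pointwise_smul_def]
  congr 1

/-! ### Choice of coset representatives `σ_p` with `σ_p · p = 0` -/

/-- `g⁻¹ · (g · p) = p`. -/
theorem act_inv_act (g : Perm (Fin 4)) (p : Pairing) : act g⁻¹ (act g p) = p := by
  rw [← act_mul, inv_mul_cancel, act_one]

/-- `g · (g⁻¹ · p) = p`. -/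
theorem act_act_inv (g : Perm (Fin 4)) (p : Pairing) : act g (act g⁻¹ p) = p := by
  rw [← act_mul, mul_inv_cancel, act_one]

/-- `act g` is injective. -/
theorem act_left_cancel {g : Perm (Fin 4)} {p q : Pairing} : act g p = act g q ↔ p = q :=
  ⟨fun e => by simpa only [act_inv_act] using congrArg (act g⁻¹) e, fun e => e ▸ rfl⟩

/-- For every pairing `p` some `σ ∈ G` moves it to `0` (`A₄ ≤ G` is transitive on pairings). -/
theorem exists_act_perm4_eq_zero (h12 : 12 ∣ Nat.card (G f)) (p : Pairing) : ∃ σ : G f, act (perm4 h σ) p = 0 := by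
  obtain ⟨τ, hτ, hτp⟩ := exists_even_act_zero_eq p
  obtain ⟨a, ha⟩ := exists_perm4_eq h h12 τ hτ
  refine ⟨a⁻¹, ?_⟩
  rw [map_inv, ← hτp, ← ha, ← act_mul, inv_mul_cancel, act_one]

/-- A chosen `σ_p ∈ G` with `σ_p · p = 0`. -/
def sigmaP (h12 : 12 ∣ Nat.card (G f)) (p : Pairing) : G f := Classical.choose (exists_act_perm4_eq_zero h h12 p)

/-- `σ_p · p = 0`. -/
theorem act_sigmaP (h12 : 12 ∣ Nat.card (G f)) (p : Pairing) : act (perm4 h (sigmaP h h12 p)) p = 0 :=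
  Classical.choose_spec (exists_act_perm4_eq_zero h h12 p)

/-- `σ_p⁻¹ · 0 = p`. -/
theorem act_sigmaP_inv (h12 : 12 ∣ Nat.card (G f)) (p : Pairing) : act (perm4 h (sigmaP h h12 p)⁻¹) 0 = p := by
  rw [← act_sigmaP h h12 p, ← act_mul, ← map_mul, inv_mul_cancel, map_one, act_one]

/-- Elements moving `p` to `0` differ by `H` on the left: `τ · p = 0 → τ σ_p⁻¹ ∈ H`. -/
theorem mul_sigmaP_inv_mem (h12 : 12 ∣ Nat.card (G f)) {p : Pairing} {τ : G f} (hτ : act (perm4 h τ) p = 0) :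
    τ * (sigmaP h h12 p)⁻¹ ∈ stabPairing h := by
  rw [mem_stabPairing, map_mul, act_mul, act_sigmaP_inv, hτ]

/-! ### The primes above `v`: the map `placeOf` -/

section Primes

variable (h12 : 12 ∣ Nat.card (G f)) (W : Ideal (𝓞 (M f))) (v : HeightOneSpectrum (𝓞 K))
  (hv : v.asIdeal = W.under (𝓞 K))

/-- Conjugates of a prime are prime. -/
instance isPrime_smul (σ : G f) [W.IsPrime] : (σ • W).IsPrime := by
  rw [Ideal.pointwise_smul_eq_comap]; infer_instance

include hv in
/-- A conjugate `σ W` meets `𝓞 E` in a non-zero prime. -/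
theorem under_smul_ne_bot (σ : G f) : (σ • W).under (𝓞 (E h)) ≠ ⊥ := by
  intro h0
  apply v.ne_bot
  rw [hv, ← Ideal.under_smul (A := 𝓞 K) (g := σ) W, ← Ideal.under_under (B := 𝓞 (E h)) (σ • W), h0]
  exact Ideal.comap_bot_of_injective _ (FaithfulSMul.algebraMap_injective _ _)

/-- **The place of `E` below `σ_p W`.** -/
def placeOf [W.IsMaximal] (p : Pairing) : HeightOneSpectrum (𝓞 (E h)) where
  asIdeal := ((sigmaP h h12 p) • W).under (𝓞 (E h))
  isPrime := Ideal.IsPrime.under _ _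
  ne_bot := under_smul_ne_bot h W v hv _

/-- `placeOf p` lies over `v`. -/
theorem placeOf_under [W.IsMaximal] (p : Pairing) : (placeOf h h12 W v hv p).under (𝓞 K) = v := by
  apply HeightOneSpectrum.ext
  rw [HeightOneSpectrum.under_asIdeal, placeOf, Ideal.under_under, Ideal.under_smul, ← hv]

variable {W v hv}

/-- **Every place of `E` above `v` is a `placeOf`**: a prime `W'` of `𝓞 M` above the place `w` is
`G`-conjugate to `W` (transitivity above `v`), `W' = τ W`, and then `w = placeOf (τ⁻¹ · 0)`. -/
theorem exists_placeOf_eq [W.IsMaximal] (hG : IsGalois K (M f)) {w : HeightOneSpectrum (𝓞 (E h))}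
    (hw : w.under (𝓞 K) = v) : ∃ p : Pairing, placeOf h h12 W v hv p = w := by
  haveI := hG
  haveI : IsGaloisGroup (G f) K (M f) := IsGaloisGroup.of_isGalois K (M f)
  haveI := w.isMaximal
  -- a prime `W'` of `𝓞 M` above `w`
  obtain ⟨W', hW'max, hW'⟩ := Ideal.exists_maximal_ideal_liesOver_of_isIntegral (S := 𝓞 (M f)) w.asIdeal
  -- `W'` and `W` both lie over `v`
  haveI : w.asIdeal.LiesOver v.asIdeal := ⟨(congrArg HeightOneSpectrum.asIdeal hw).symm⟩
  haveI : W'.LiesOver v.asIdeal := Ideal.LiesOver.trans W' w.asIdeal v.asIdeal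
  haveI : W.LiesOver v.asIdeal := ⟨hv⟩
  haveI := v.isMaximal.isPrime
  obtain ⟨τ, hτ⟩ := Ideal.exists_smul_eq_of_isGaloisGroup v.asIdeal W W' (G f)
  refine ⟨act (perm4 h τ⁻¹) 0, HeightOneSpectrum.ext ?_⟩
  -- `σ_p = η τ` with `η ∈ H`
  set p := act (perm4 h τ⁻¹) 0 with hp
  have hτp : act (perm4 h τ) p = 0 := by rw [hp, ← act_mul, ← map_mul, mul_inv_cancel, map_one, act_one]
  have hη := mul_sigmaP_inv_mem h h12 hτp
  set η : stabPairing h := ⟨τ * (sigmaP h h12 p)⁻¹, hη⟩ with hηdef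
  have hσ : sigmaP h h12 p = (η : G f)⁻¹ * τ := by rw [hηdef]; group
  show ((sigmaP h h12 p) • W).under (𝓞 (E h)) = w.asIdeal
  rw [hσ, mul_smul, hτ, hW'.over]
  -- `η⁻¹ ∈ Gal(M/E)` does not move the prime below
  have : ((η : G f)⁻¹ • W') = (toGE h η⁻¹) • W' := by rw [toGE_smul_ideal]; rfl
  rw [this, Ideal.under_smul]

/-- **Fibres of `placeOf` are the `⟨Stab W⟩`-orbits**: `placeOf p = placeOf p'` iff
`p' = d · p` for some `d ∈ Stab_G(W)`. -/
theorem placeOf_eq_placeOf_iff [W.IsMaximal] (hG : IsGalois K (M f)) (p p' : Pairing) :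
    placeOf h h12 W v hv p = placeOf h h12 W v hv p' ↔
      ∃ d : G f, d • W = W ∧ act (perm4 h d) p = p' := by
  haveI := hG
  haveI : IsGaloisGroup (G f) K (M f) := IsGaloisGroup.of_isGalois K (M f)
  constructor
  · intro hpp
    have hI : ((sigmaP h h12 p) • W).under (𝓞 (E h)) = ((sigmaP h h12 p') • W).under (𝓞 (E h)) :=
      congrArg HeightOneSpectrum.asIdeal hpp
    -- transitivity of `Gal(M/E)` on the primes above this prime of `𝓞 E`
    set Q := ((sigmaP h h12 p) • W).under (𝓞 (E h)) with hQ
    haveI : Q.IsPrime := Ideal.IsPrime.under _ _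
    haveI : ((sigmaP h h12 p) • W).LiesOver Q := ⟨rfl⟩
    haveI : ((sigmaP h h12 p') • W).LiesOver Q := ⟨hI⟩
    haveI : IsGalois (E h) (M f) := IsGalois.tower_top_intermediateField (E h)
    haveI : IsGaloisGroup (GE h) (E h) (M f) := IsGaloisGroup.of_isGalois (E h) (M f)
    obtain ⟨φ, hφ⟩ := Ideal.exists_smul_eq_of_isGaloisGroup Q ((sigmaP h h12 p) • W) ((sigmaP h h12 p') • W) (GE h)
    set η : stabPairing h := (toGE h).symm φ with hη
    have hφ' : (η : G f) • ((sigmaP h h12 p) • W) = (sigmaP h h12 p') • W := by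
      rw [← toGE_smul_ideal, hη, MulEquiv.apply_symm_apply, hφ]
    refine ⟨(sigmaP h h12 p')⁻¹ * (η : G f) * sigmaP h h12 p, ?_, ?_⟩
    · rw [mul_smul, mul_smul, hφ', ← mul_smul, inv_mul_cancel, one_smul]
    · rw [map_mul, map_mul, act_mul, act_mul, act_sigmaP, (mem_stabPairing h _).mp η.2, act_sigmaP_inv]
  · rintro ⟨d, hdW, hdp⟩
    apply HeightOneSpectrum.ext
    show ((sigmaP h h12 p) • W).under (𝓞 (E h)) = ((sigmaP h h12 p') • W).under (𝓞 (E h))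
    -- `σ_p d⁻¹ · p' = 0`, so `σ_p d⁻¹ = η σ_{p'}` with `η ∈ H`
    have h1 : act (perm4 h (sigmaP h h12 p * d⁻¹)) p' = 0 := by
      rw [map_mul, act_mul, map_inv, ← hdp, act_inv_act, act_sigmaP]
    have hη := mul_sigmaP_inv_mem h h12 h1
    set η : stabPairing h := ⟨sigmaP h h12 p * d⁻¹ * (sigmaP h h12 p')⁻¹, hη⟩ with hηdef
    have hσ : sigmaP h h12 p = (η : G f) * sigmaP h h12 p' * d := by rw [hηdef]; group
    rw [hσ, mul_smul, mul_smul, hdW]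
    have : ((η : G f) • (sigmaP h h12 p' • W)) = (toGE h η) • (sigmaP h h12 p' • W) := by rw [toGE_smul_ideal]
    rw [this, Ideal.under_smul]

end Primes

/-! ### Orbits of `⟨g⟩` on the pairings (finite bookkeeping on `Fin 4`) -/

/-- The `⟨τ⟩`-orbit `{p, τ p, τ² p}` of the pairing `p`, as a finset. -/
def orbitFinset (τ : Perm (Fin 4)) (p : Pairing) : Finset Pairing := {p, act τ p, act τ (act τ p)}

/-- The orbit finset has `period τ p` elements. -/
theorem card_orbitFinset : ∀ (τ : Perm (Fin 4)) (p : Pairing), (orbitFinset τ p).card = period τ p := by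
  decide +kernel

/-- Every element of `S₄` has order dividing `12`. -/
theorem perm_pow_twelve : ∀ τ : Perm (Fin 4), τ ^ 12 = 1 := by decide +kernel

/-- All powers `τ ^ k`, `k < 12`, keep `p` inside the orbit finset. -/
theorem act_pow_mem_orbitFinset : ∀ (τ : Perm (Fin 4)) (p : Pairing) (k : Fin 12),
    act (τ ^ (k : ℕ)) p ∈ orbitFinset τ p := by
  decide +kernel

/-- All integer powers keep `p` inside the orbit finset. -/
theorem act_zpow_mem_orbitFinset (τ : Perm (Fin 4)) (p : Pairing) (k : ℤ) :
    act (τ ^ k) p ∈ orbitFinset τ p := by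
  have h12 : (12 : ℤ) ≠ 0 := by norm_num
  have hk : τ ^ k = τ ^ ((k % 12).toNat) := by
    rw [zpow_eq_zpow_emod' k (perm_pow_twelve τ), ← zpow_natCast, Int.toNat_of_nonneg (Int.emod_nonneg k h12)]
    rfl
  rw [hk]
  have hlt : (k % 12).toNat < 12 := by
    have := Int.emod_lt_of_pos k (by norm_num : (0 : ℤ) < 12)
    omega
  exact act_pow_mem_orbitFinset τ p ⟨_, hlt⟩

/-! ### The residue degree of `placeOf p` is the period of `p` -/

section Degree

variable (h12 : 12 ∣ Nat.card (G f)) (W : Ideal (𝓞 (M f))) [W.IsMaximal] (v : HeightOneSpectrum (𝓞 K))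
  (hv : v.asIdeal = W.under (𝓞 K))

/-- `σ W ≠ ⊥` (a maximal ideal of the Dedekind domain `𝓞 M`, which is not a field). -/
theorem smul_ne_bot (σ : G f) : σ • W ≠ ⊥ := fun h0 =>
  Ring.ne_bot_of_isMaximal_of_not_isField inferInstance (RingOfIntegers.not_isField (M f))
    ((Literature.NumberTheory.Automorphic.Ideal.smul_eq_bot_iff σ W).mp h0)

/-- The place of `M` given by the conjugate prime `σ W`. -/
def placeM (σ : G f) : HeightOneSpectrum (𝓞 (M f)) := ⟨σ • W, inferInstance, smul_ne_bot W σ⟩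

/-- `τ • placeM σ = placeM (τ σ)`. -/
theorem smul_placeM (τ σ : G f) : τ • placeM W σ = placeM W (τ * σ) := by
  apply HeightOneSpectrum.ext
  rw [Literature.NumberTheory.Automorphic.HeightOneSpectrum.smul_asIdeal]
  show τ • (σ • W) = (τ * σ) • W
  rw [mul_smul]

/-- The stabiliser of the place `σ W` is the conjugate `σ Stab(W) σ⁻¹` of the stabiliser of the ideal `W`. -/
theorem mem_stabilizer_placeM_iff (σ x : G f) :
    x ∈ MulAction.stabilizer (G f) (placeM W σ) ↔ σ⁻¹ * x * σ ∈ MulAction.stabilizer (G f) W := by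
  rw [MulAction.mem_stabilizer_iff, MulAction.mem_stabilizer_iff, smul_placeM, HeightOneSpectrum.ext_iff]
  show (x * σ) • W = σ • W ↔ (σ⁻¹ * x * σ) • W = W
  rw [mul_assoc, mul_smul σ⁻¹, inv_smul_eq_iff]

/-- `placeOf p` is the place of `E` below `placeM σ_p`. -/
theorem placeM_under_E (p : Pairing) :
    (placeM W (sigmaP h h12 p)).asIdeal.under (𝓞 (E h)) = (placeOf h h12 W v hv p).asIdeal := rfl

/-- **`#Stab_G(σ W) = #Stab_G(W)`.** -/
theorem card_stabilizer_placeM (σ : G f) :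
    Nat.card (MulAction.stabilizer (G f) (placeM W σ)) = Nat.card (MulAction.stabilizer (G f) W) := by
  have hy : ∀ y : G f, σ⁻¹ * (σ * y * σ⁻¹) * σ = y := fun y => by group
  refine Nat.card_congr ⟨fun x => ⟨σ⁻¹ * (x : G f) * σ, (mem_stabilizer_placeM_iff W σ x).mp x.2⟩,
    fun y => ⟨σ * (y : G f) * σ⁻¹, (mem_stabilizer_placeM_iff W σ _).mpr (by rw [hy]; exact y.2)⟩,
    fun x => Subtype.ext (by simp [mul_assoc]), fun y => Subtype.ext (by simp [mul_assoc])⟩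

/-- **`Stab_{Gal(M/E)}(σ W) ≅ {d ∈ Stab_G(W) | d · (σ⁻¹ 0) = σ⁻¹ 0}`** (conjugate by `σ`, then
`σ d σ⁻¹ ∈ H ↔ d` fixes the pairing `σ⁻¹ · 0`). -/
theorem card_stabilizer_GE_placeM (σ : G f) :
    Nat.card (MulAction.stabilizer (GE h) (placeM W σ)) =
      Nat.card {d : MulAction.stabilizer (G f) W //
        act (perm4 h (d : G f)) (act (perm4 h σ)⁻¹ 0) = act (perm4 h σ)⁻¹ 0} := by
  -- membership in the `GE`-stabiliser, read on `G`
  have key : ∀ φ : GE h, φ ∈ MulAction.stabilizer (GE h) (placeM W σ) ↔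
      ((toGE h).symm φ : G f) ∈ MulAction.stabilizer (G f) (placeM W σ) := by
    intro φ
    rw [MulAction.mem_stabilizer_iff, MulAction.mem_stabilizer_iff, HeightOneSpectrum.ext_iff,
      HeightOneSpectrum.ext_iff, Literature.NumberTheory.Automorphic.HeightOneSpectrum.smul_asIdeal,
      Literature.NumberTheory.Automorphic.HeightOneSpectrum.smul_asIdeal]
    show φ • (σ • W) = σ • W ↔ ((toGE h).symm φ : G f) • (σ • W) = σ • W
    rw [← toGE_smul_ideal, MulEquiv.apply_symm_apply]
  have hH : ∀ x : G f, x ∈ stabPairing h ↔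
      act (perm4 h (σ⁻¹ * x * σ)) (act (perm4 h σ)⁻¹ 0) = act (perm4 h σ)⁻¹ 0 := by
    intro x
    rw [mem_stabPairing, map_mul, map_mul, map_inv, act_mul, act_mul, act_act_inv, act_left_cancel]
  have hy : ∀ y : G f, σ⁻¹ * (σ * y * σ⁻¹) * σ = y := fun y => by group
  refine Nat.card_congr
    ⟨fun φ => ⟨⟨σ⁻¹ * ((toGE h).symm φ.1 : G f) * σ,
        (mem_stabilizer_placeM_iff W σ _).mp ((key φ.1).mp φ.2)⟩,
        (hH _).mp ((toGE h).symm φ.1).2⟩,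
     fun d => ⟨toGE h ⟨σ * (d.1 : G f) * σ⁻¹, (hH _).mpr (by rw [hy]; exact d.2)⟩,
        (key _).mpr (by
          rw [MulEquiv.symm_apply_apply]
          exact (mem_stabilizer_placeM_iff W σ _).mpr (by rw [hy]; exact d.1.2))⟩,
     fun φ => ?_, fun d => ?_⟩
  · apply Subtype.ext
    apply (toGE h).symm.injective
    apply Subtype.ext
    simp [mul_assoc]
  · apply Subtype.ext; apply Subtype.ext
    simp [mul_assoc]

end Degree

/-! ### `f(placeOf p | v) = period (perm4 g) p` for a Frobenius generator `g` of `D_W` -/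

section InertiaDeg

variable (h12 : 12 ∣ Nat.card (G f)) (W : Ideal (𝓞 (M f))) [W.IsMaximal] (v : HeightOneSpectrum (𝓞 K))
  (hv : v.asIdeal = W.under (𝓞 K))

/-- **Orbit–stabiliser in a cyclic subgroup `D = ⟨g⟩ ≤ G` acting on the pairings through `perm4`:**
`#D = period (perm4 g) p · #{d ∈ D | d · p = p}` (the orbit of `p` is `{p, g p, g² p}`, of size
`period (perm4 g) p`). -/
theorem card_eq_period_mul (g : G f) (D : Subgroup (G f)) (hD : D = Subgroup.zpowers g) (p : Pairing) :
    Nat.card D = period (perm4 h g) p * Nat.card {d : D // act (perm4 h (d : G f)) p = p} := by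
  subst hD
  letI : MulAction (Subgroup.zpowers g) Pairing :=
    MulAction.compHom Pairing ((pairingPerm h).comp (Subgroup.zpowers g).subtype)
  have hsmul : ∀ (d : Subgroup.zpowers g) (q : Pairing), d • q = act (perm4 h (d : G f)) q := fun d q => by
    rw [MulAction.compHom_smul_def, Perm.smul_def, MonoidHom.comp_apply, Subgroup.subtype_apply,
      pairingPerm_apply]
  have horbit : MulAction.orbit (Subgroup.zpowers g) p = ↑(orbitFinset (perm4 h g) p) := by
    ext q
    constructor
    · rintro ⟨d, rfl⟩
      obtain ⟨k, hk⟩ := Subgroup.mem_zpowers_iff.mp d.2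
      show d • p ∈ _
      rw [Finset.mem_coe, hsmul, ← hk, map_zpow]
      exact act_zpow_mem_orbitFinset _ _ _
    · intro hq
      rw [Finset.mem_coe, orbitFinset, Finset.mem_insert, Finset.mem_insert, Finset.mem_singleton] at hq
      rw [MulAction.mem_orbit_iff]
      rcases hq with rfl | rfl | rfl
      · exact ⟨1, one_smul _ _⟩
      · exact ⟨⟨g, Subgroup.mem_zpowers g⟩, by rw [hsmul]⟩
      · exact ⟨⟨g * g, Subgroup.mul_mem _ (Subgroup.mem_zpowers g) (Subgroup.mem_zpowers g)⟩,
          by rw [hsmul, map_mul, act_mul]⟩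
  have hstab : Nat.card (MulAction.stabilizer (Subgroup.zpowers g) p) =
      Nat.card {d : Subgroup.zpowers g // act (perm4 h (d : G f)) p = p} :=
    Nat.card_congr (Equiv.subtypeEquivRight fun d => by rw [MulAction.mem_stabilizer_iff, hsmul])
  rw [← hstab, ← Subgroup.index_mul_card (MulAction.stabilizer (Subgroup.zpowers g) p),
    MulAction.index_stabilizer, horbit, Set.ncard_coe_finset, card_orbitFinset]

include hv in
/-- `v` unramified in `M` ⇒ every place `w` of `E` above `v` is unramified in `M`
(`Algebra.IsUnramifiedAt.of_restrictScalars` along `𝓞 K → 𝓞 E → 𝓞 M`). -/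
theorem isUnramifiedIn_placeOf (hunr : Algebra.IsUnramifiedIn (𝓞 (M f)) v.asIdeal) (p : Pairing) :
    Algebra.IsUnramifiedIn (𝓞 (M f)) (placeOf h h12 W v hv p).asIdeal := by
  intro Q hQ hQover
  have hQv : Q.LiesOver v.asIdeal := by
    constructor
    rw [← Ideal.under_under (B := 𝓞 (E h)) Q, ← hQover.over, ← HeightOneSpectrum.under_asIdeal,
      placeOf_under]
  haveI := hunr Q hQ hQv
  exact Algebra.IsUnramifiedAt.of_restrictScalars (𝓞 K) Q

include hv in
/-- **The residue degree of `placeOf p` over `v` is the size of the `⟨g⟩`-orbit of `p`**, for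
`M/K` Galois, `v` unramified in `M` and `D_W = ⟨g⟩` (e.g. `g` the Frobenius at `W`):
`f(σ_p W | v) = #D_W`, `f(σ_p W | placeOf p) = #Stab_{⟨g⟩}(p)` (decomposition groups at unramified
places, `card_stabilizer_placeM`, `card_stabilizer_GE_placeM`), the tower formula
`f(σ_p W | v) = f(placeOf p | v) · f(σ_p W | placeOf p)` and orbit–stabiliser in `⟨g⟩`. -/
theorem inertiaDeg_placeOf (hG : IsGalois K (M f)) (hunr : Algebra.IsUnramifiedIn (𝓞 (M f)) v.asIdeal)
    (g : G f) (hD : MulAction.stabilizer (G f) W = Subgroup.zpowers g) (p : Pairing) :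
    (placeOf h h12 W v hv p).asIdeal.inertiaDeg (𝓞 K) = period (perm4 h g) p := by
  haveI := hG
  set P := placeM W (sigmaP h h12 p) with hP
  have hPv : P.asIdeal.under (𝓞 K) = v.asIdeal := by
    rw [hv]; exact Ideal.under_smul (A := 𝓞 K) (g := sigmaP h h12 p) W
  have hPw : P.asIdeal.under (𝓞 (E h)) = (placeOf h h12 W v hv p).asIdeal := placeM_under_E h h12 W v hv p
  -- decomposition groups at the unramified places `P | v` and `P | placeOf p`
  have h1 := Literature.NumberTheory.Automorphic.HeightOneSpectrum.card_stabilizer_eq_inertiaDeg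
    (F := K) (L := M f) hPv hunr
  have h2 := Literature.NumberTheory.Automorphic.HeightOneSpectrum.card_stabilizer_eq_inertiaDeg
    (F := E h) (L := M f) hPw (isUnramifiedIn_placeOf h h12 W v hv hunr p)
  -- the tower formula
  haveI : P.asIdeal.LiesOver (placeOf h h12 W v hv p).asIdeal := ⟨hPw.symm⟩
  have h3 := Ideal.inertiaDeg_tower (placeOf h h12 W v hv p).asIdeal P.asIdeal (R := 𝓞 K)
  -- the group-theoretic cardinalities
  rw [card_stabilizer_placeM, hD] at h1
  rw [card_stabilizer_GE_placeM, ← map_inv, act_sigmaP_inv] at h2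
  have h4 := card_eq_period_mul h g (MulAction.stabilizer (G f) W) hD p
  rw [hD] at h4
  have hpos : 0 < Nat.card {d : Subgroup.zpowers g // act (perm4 h (d : G f)) p = p} :=
    Nat.card_pos_iff.mpr ⟨⟨⟨1, by rw [OneMemClass.coe_one, map_one]; exact act_one p⟩⟩, inferInstance⟩
  rw [hD] at h2
  rw [h3, ← h2] at h1
  rw [h1] at h4
  exact Nat.eq_of_mul_eq_mul_right hpos h4

end InertiaDeg

end Summit.Langlands.Langlands.Theorems.ResidualAutomorphyEven
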